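import Summits.HodgeConjecture.CorCM.Census.BaseBlockCoveringJoint

/-!
# Base-block covering on a prescribed set of far blocks: joint fibre-independence with an explicit near family

COR-CM (cell `pub-hodgecm2`), count-neutral kernel combinatorics by the binder seat b09 (gen 39; lane QUATERNION COLUMN, generic part),
sequel of part L `Census/BaseBlockCoveringJoint.lean` (`exists_joint_cover`, `par_eq_liftQ_mkQ`) on parts C/E (`bpot`, `exists_choice`,
`par_cover_self/other`, `blk_out`, `mem_sdiff_rt_iff`) used BY NAME.  Theorems only: no definition, no `decide`, no certificate, no named
fact, no `sorry`.  HONEST FRAMING: `HC_CM` is NOT proved, here or anywhere in the tree; nothing here is a period or a headline.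

WHY.  Part L covers the blocks above a potential THRESHOLD `ρ` and keeps fibre-independence with a near family vanishing on them.  A column
whose closing must travel far from the base type (the quaternion column `Q_{4n}`: the biarc circle reaches potential `n/2`,
`Census/QuaternionColumnCircle.lean`) covers some far blocks EXPLICITLY (the biarc blocks, the coincidence blocks of its chains) and wants the
generic covering only on the REMAINING far blocks — an arbitrary set, not a threshold set.  This file is part L for an arbitrary decidable set
`far` of blocks of potential `≥ 2`:

**THEOREM (`exists_joint_cover_on`).**  Let `far` be a decidable predicate on blocks with `far B → 2 ≤ bpot B`, and `S₁` a finite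
fibre-independent family of integer vectors whose block parities vanish on every `far` block.  Then there is `S₂ ⊆ gfaceSet` — EXACTLY one
face per `far` block, disjoint from `S₁`, with the pivot profile (`par = 1` at its block, `0` at every other block of potential at least its own)
and the `toward a nearest base change` property through every type of a `far` block modulo any lattice containing its base changes — such
that `S₁ ∪ S₂` is FIBRE-INDEPENDENT.  The proof is part Lʼs, verbatim on the set.
**COROLLARY (`toward_all_of_on`).**  If moreover every block of potential `≥ 2` which is NOT `far` has an explicit `toward` face in the
lattice, the `toward` property holds through every type of potential `≥ 2` (the input of `descent_of_toward` / `star_of_toward`).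

## References
* [Pohlmann1968] H. Pohlmann, Algebraic cycles on abelian varieties of complex multiplication type, Ann. of Math. 88 (1968), Thm 1.
-/

namespace Summit.HodgeConjecture.CorCM.Census.BaseBlock

open Finset
open Summit.HodgeConjecture.CorCM.Prior.AllgGroup.RfwfAllgGroup
open Summit.HodgeConjecture.CorCM.Census.BlockParity
open Summit.HodgeConjecture.CorCM.Census.Coinvariant
open Summit.HodgeConjecture.CorCM.Census.TwistGeneration

noncomputable section

variable {G : Type*} [Group G] [Fintype G] [DecidableEq G] (c : G) (T₀ : CMF G c)

/-- **THE JOINT COVERING ON A SET OF FAR BLOCKS.**  See the file header. [folklore] -/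
theorem exists_joint_cover_on (hc2 : c * c = 1) (far : Block c → Prop) [DecidablePred far]
    (hfar2 : ∀ B : Block c, far B → 2 ≤ bpot c T₀ B.out) (S₁ : Finset (CMF G c →₀ ℤ))
    (hli₁ : LinearIndepOn (ZMod 2) (fun f : CMF G c →₀ ℤ => (rad2 c hc2).mkQ (red c f)) ↑S₁)
    (hfar₁ : ∀ f ∈ S₁, ∀ B : Block c, far B → par c f B = 0) :
    ∃ S₂ : Finset (CMF G c →₀ ℤ), (↑S₂ ⊆ gfaceSet G c hc2) ∧
      S₂.card = (univ.filter fun Bk : Block c => far Bk).card ∧ Disjoint S₁ S₂ ∧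
      LinearIndepOn (ZMod 2) (fun f : CMF G c →₀ ℤ => (rad2 c hc2).mkQ (red c f)) ↑(S₁ ∪ S₂) ∧
      (∀ f ∈ S₂, ∃ Ψ : CMF G c, far (blk c Ψ) ∧ par c f (blk c Ψ) = 1 ∧
        ∀ B : Block c, B ≠ blk c Ψ → bpot c T₀ Ψ ≤ bpot c T₀ B.out → par c f B = 0) ∧
      ∀ L : Submodule ℤ (CMF G c →₀ ℤ), Submodule.span ℤ (translates c S₂) ≤ L →
        ∀ Φ : CMF G c, far (blk c Φ) → ∃ Q t t' : G, bpot c T₀ Φ = ddist (rt c Q T₀) Φ ∧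
          t ∈ (rt c Q T₀).1 \ Φ.1 ∧ t' ∈ (rt c Q T₀).1 \ Φ.1 ∧ t ≠ t' ∧ gface c hc2 Φ t t' ∈ L := by
  classical
  have hch : ∀ Bk : Block c, ∃ τ : G × G × G, far Bk →
      bpot c T₀ Bk.out = ddist (rt c τ.1 T₀) Bk.out ∧
        τ.2.1 ∈ (rt c τ.1 T₀).1 \ Bk.out.1 ∧ τ.2.2 ∈ (rt c τ.1 T₀).1 \ Bk.out.1 ∧ τ.2.1 ≠ τ.2.2 := by
    intro Bk
    by_cases h : far Bk
    · obtain ⟨Q, t, t', h1, h3, h4, h5⟩ := exists_choice c T₀ Bk.out (hfar2 Bk h)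
      exact ⟨(Q, t, t'), fun _ => ⟨h1, h3, h4, h5⟩⟩
    · exact ⟨(1, 1, 1), fun h' => absurd h' h⟩
  choose τ hτ using hch
  set NI : Finset (Block c) := univ.filter fun Bk : Block c => far Bk with hNI
  set face : Block c → (CMF G c →₀ ℤ) := fun Bk => gface c hc2 Bk.out (τ Bk).2.1 (τ Bk).2.2 with hfaceDef
  set S₂ : Finset (CMF G c →₀ ℤ) := NI.image face with hS₂
  have hmemNI : ∀ {Bk : Block c}, Bk ∈ NI ↔ far Bk := fun {Bk} => by rw [hNI, mem_filter]; simp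
  have hself : ∀ Bk ∈ NI, par c (face Bk) Bk = 1 := by
    intro Bk hBk
    obtain ⟨h1, h3, h4, h5⟩ := hτ Bk (hmemNI.mp hBk)
    have h := par_cover_self c T₀ hc2 h1 h3 h4 h5
    rwa [blk_out] at h
  have hother : ∀ Bk ∈ NI, ∀ B : Block c, B ≠ Bk → bpot c T₀ Bk.out ≤ bpot c T₀ B.out → par c (face Bk) B = 0 := by
    intro Bk hBk B hB hle
    obtain ⟨h1, h3, h4, h5⟩ := hτ Bk (hmemNI.mp hBk)
    exact par_cover_other c T₀ hc2 h1 h3 h4 h5 (by rw [blk_out]; exact hB) hle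
  have hinj : Set.InjOn face ↑NI := by
    intro B₁ hB₁ B₂ hB₂ heq
    by_contra hne
    rcases le_total (bpot c T₀ B₁.out) (bpot c T₀ B₂.out) with hle | hle
    · have h0 := hother B₁ hB₁ B₂ (Ne.symm hne) hle
      rw [heq, hself B₂ hB₂] at h0
      exact one_ne_zero h0
    · have h0 := hother B₂ hB₂ B₁ hne hle
      rw [← heq, hself B₁ hB₁] at h0
      exact one_ne_zero h0
  have hSsub : (↑S₂ : Set (CMF G c →₀ ℤ)) ⊆ gfaceSet G c hc2 := by
    intro y hy
    obtain ⟨Bk, hBk, rfl⟩ := mem_image.mp (mem_coe.mp hy)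
    obtain ⟨-, h3, h4, h5⟩ := hτ Bk (hmemNI.mp hBk)
    exact ⟨Bk.out, _, _, not_mem_orb_of_mem (mem_sdiff.mp h3).1 (mem_sdiff.mp h4).1 h5, rfl⟩
  have hnot : ∀ Bk ∈ NI, face Bk ∉ S₁ := by
    intro Bk hBk hmem
    have h0 := hfar₁ _ hmem Bk (hmemNI.mp hBk)
    rw [hself Bk hBk] at h0
    exact one_ne_zero h0
  have hdisj : Disjoint S₁ S₂ := by
    rw [Finset.disjoint_right]
    intro f hf
    obtain ⟨Bk, hBk, rfl⟩ := mem_image.mp hf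
    exact hnot Bk hBk
  refine ⟨S₂, hSsub, card_image_of_injOn hinj, hdisj, ?_, ?_, fun L hL Φ hΦ => ?_⟩
  · -- JOINT fibre independence (verbatim part L)
    set p : (CMF G c →₀ ℤ) → Block c := fun f => if h : ∃ Bk ∈ NI, face Bk = f then h.choose else blk c T₀ with hp
    have hpf : ∀ Bk ∈ NI, p (face Bk) = Bk := by
      intro Bk hBk
      have h : ∃ B ∈ NI, face B = face Bk := ⟨Bk, hBk, rfl⟩
      rw [hp]; simp only [dif_pos h]
      exact hinj h.choose_spec.1 hBk h.choose_spec.2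
    rw [linearIndepOn_iff]
    intro l hl hsum
    set Pbar := (rad2 c hc2).liftQ (par2 c) (rad2_le_ker_par2 c hc2) with hPbar
    have hpar : ∑ f ∈ l.support, l f • par c f = 0 := by
      have h := congrArg Pbar hsum
      rw [map_zero, Finsupp.linearCombination_apply, Finsupp.sum, map_sum] at h
      rw [← h]
      refine Finset.sum_congr rfl fun f _ => ?_
      rw [map_smul, par_eq_liftQ_mkQ c hc2 f]
    have hsupp : ∀ f ∈ l.support, f ∈ S₁ ∨ f ∈ S₂ := fun f hf => by
      have h := (Finsupp.mem_supported _ l).mp hl hf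
      rw [coe_union] at h
      rcases h with h | h
      · exact Or.inl h
      · exact Or.inr h
    have hfarzero : ∀ f ∈ l.support, f ∈ S₂ → l f = 0 := by
      by_contra hbad
      push Not at hbad
      obtain ⟨f₁, hf₁, hf₁S, hlf₁⟩ := hbad
      obtain ⟨i₀, hi₀, hmax⟩ := Finset.exists_max_image (l.support.filter fun f => f ∈ S₂ ∧ l f ≠ 0)
        (fun f => bpot c T₀ (p f).out) ⟨f₁, mem_filter.mpr ⟨hf₁, hf₁S, hlf₁⟩⟩
      obtain ⟨hi₀s, hi₀S, hli₀⟩ := mem_filter.mp hi₀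
      obtain ⟨B₀, hB₀, hfB₀⟩ := mem_image.mp hi₀S
      have hp₀ : p i₀ = B₀ := by rw [← hfB₀]; exact hpf B₀ hB₀
      have heval := congrFun hpar B₀
      rw [Finset.sum_apply, Pi.zero_apply, Finset.sum_eq_single_of_mem i₀ hi₀s] at heval
      · rw [Pi.smul_apply, smul_eq_mul, ← hfB₀, hself B₀ hB₀, mul_one] at heval
        exact hli₀ (hfB₀ ▸ heval)
      · intro f hf hfi
        rw [Pi.smul_apply, smul_eq_mul]
        by_cases hlf : l f = 0
        · rw [hlf, zero_mul]
        rcases hsupp f hf with h1 | h2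
        · rw [hfar₁ f h1 B₀ (hmemNI.mp hB₀), mul_zero]
        · obtain ⟨Bf, hBf, hfBf⟩ := mem_image.mp h2
          have hpj : p f = Bf := by rw [← hfBf]; exact hpf Bf hBf
          have hlj : bpot c T₀ Bf.out ≤ bpot c T₀ B₀.out := by
            have h := hmax f (mem_filter.mpr ⟨hf, h2, hlf⟩)
            rwa [hpj, hp₀] at h
          have hne : B₀ ≠ Bf := fun e => hfi (by rw [← hfBf, ← hfB₀, e])
          rw [← hfBf, hother Bf hBf B₀ hne hlj, mul_zero]
    have hl1 : l ∈ Finsupp.supported (ZMod 2) (ZMod 2) (↑S₁ : Set (CMF G c →₀ ℤ)) := by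
      rw [Finsupp.mem_supported]
      intro f hf
      rcases hsupp f hf with h1 | h2
      · exact h1
      · exact absurd (hfarzero f hf h2) (Finsupp.mem_support_iff.mp hf)
    exact (linearIndepOn_iff.mp hli₁) l hl1 hsum
  · -- the pivot profile of the covering faces
    intro f hf
    obtain ⟨Bk, hBk, rfl⟩ := mem_image.mp hf
    refine ⟨Bk.out, by rw [blk_out]; exact hmemNI.mp hBk, by rw [blk_out]; exact hself Bk hBk, fun B hB hle => ?_⟩
    rw [blk_out] at hB
    exact hother Bk hBk B hB hle
  · -- the `toward` property through every type of a `far` block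
    obtain ⟨Q, hQ⟩ := exists_rt_eq_of_blk_eq c (Quotient.out_eq (blk c Φ) : blk c (blk c Φ).out = blk c Φ)
    have hBNI : blk c Φ ∈ NI := hmemNI.mpr hΦ
    obtain ⟨h1, h3, h4, h5⟩ := hτ (blk c Φ) hΦ
    set R := (τ (blk c Φ)).1
    set t := (τ (blk c Φ)).2.1
    set t' := (τ (blk c Φ)).2.2
    have hmem : gface c hc2 Φ (t * Q⁻¹) (t' * Q⁻¹) ∈ L := by
      have e : gface c hc2 Φ (t * Q⁻¹) (t' * Q⁻¹) = Finsupp.mapDomain (rt c Q) (face (blk c Φ)) := by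
        rw [mapDomain_rt_gface, hQ]
      rw [e]
      exact hL (Submodule.subset_span ⟨Q, _, mem_image_of_mem _ hBNI, rfl⟩)
    have hQ' : bpot c T₀ Φ = ddist (rt c (Q * R) T₀) Φ := by
      rw [← hQ, bpot_rt, rt_mul, ddist_rt]; exact h1
    have hs : t * Q⁻¹ ∈ (rt c (Q * R) T₀).1 \ Φ.1 := by
      rw [rt_mul, ← hQ, mem_sdiff_rt_iff, inv_mul_cancel_right]; exact h3
    have hs' : t' * Q⁻¹ ∈ (rt c (Q * R) T₀).1 \ Φ.1 := by
      rw [rt_mul, ← hQ, mem_sdiff_rt_iff, inv_mul_cancel_right]; exact h4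
    have hss' : t * Q⁻¹ ≠ t' * Q⁻¹ := fun h => h5 (mul_right_cancel h)
    exact ⟨Q * R, t * Q⁻¹, t' * Q⁻¹, hQ', hs, hs', hss', hmem⟩

/-- **Transport of an explicit `toward` face along its block.**  If a lattice `L` contains all base changes of a face `gface Ψ t t'` which is
`toward` at `Ψ` (two distinct deviation places from a base change realising the potential), then `L` has a `toward` face through every type of
the block of `Ψ`. [folklore] -/
theorem toward_of_explicit (hc2 : c * c = 1) (L : Submodule ℤ (CMF G c →₀ ℤ)) {Ψ : CMF G c} {Q₀ t t' : G}
    (h1 : bpot c T₀ Ψ = ddist (rt c Q₀ T₀) Ψ) (h3 : t ∈ (rt c Q₀ T₀).1 \ Ψ.1) (h4 : t' ∈ (rt c Q₀ T₀).1 \ Ψ.1) (h5 : t ≠ t')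
    (hL : ∀ Q : G, Finsupp.mapDomain (rt c Q) (gface c hc2 Ψ t t') ∈ L) {Φ : CMF G c} (hΦ : blk c Φ = blk c Ψ) :
    ∃ Q s s' : G, bpot c T₀ Φ = ddist (rt c Q T₀) Φ ∧ s ∈ (rt c Q T₀).1 \ Φ.1 ∧ s' ∈ (rt c Q T₀).1 \ Φ.1 ∧ s ≠ s' ∧
      gface c hc2 Φ s s' ∈ L := by
  obtain ⟨Q, hQ⟩ := exists_rt_eq_of_blk_eq c hΦ.symm
  have hmem : gface c hc2 Φ (t * Q⁻¹) (t' * Q⁻¹) ∈ L := by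
    rw [← hQ, ← mapDomain_rt_gface]; exact hL Q
  have hQ' : bpot c T₀ Φ = ddist (rt c (Q * Q₀) T₀) Φ := by
    rw [← hQ, bpot_rt, rt_mul, ddist_rt]; exact h1
  have hs : t * Q⁻¹ ∈ (rt c (Q * Q₀) T₀).1 \ Φ.1 := by
    rw [rt_mul, ← hQ, mem_sdiff_rt_iff, inv_mul_cancel_right]; exact h3
  have hs' : t' * Q⁻¹ ∈ (rt c (Q * Q₀) T₀).1 \ Φ.1 := by
    rw [rt_mul, ← hQ, mem_sdiff_rt_iff, inv_mul_cancel_right]; exact h4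
  exact ⟨Q * Q₀, t * Q⁻¹, t' * Q⁻¹, hQ', hs, hs', fun h => h5 (mul_right_cancel h), hmem⟩

/-- **The full `toward` property from a covering on a set plus explicit faces off the set.**  If `L` has a `toward` face through every type of
a `far` block, and through every type of potential `≥ 2` whose block is not `far`, then through every type of potential `≥ 2`. [folklore] -/
theorem toward_all_of_on (hc2 : c * c = 1) (far : Block c → Prop) (L : Submodule ℤ (CMF G c →₀ ℤ))
    (hon : ∀ Φ : CMF G c, far (blk c Φ) → ∃ Q t t' : G, bpot c T₀ Φ = ddist (rt c Q T₀) Φ ∧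
      t ∈ (rt c Q T₀).1 \ Φ.1 ∧ t' ∈ (rt c Q T₀).1 \ Φ.1 ∧ t ≠ t' ∧ gface c hc2 Φ t t' ∈ L)
    (hoff : ∀ Φ : CMF G c, 2 ≤ bpot c T₀ Φ → ¬ far (blk c Φ) → ∃ Q t t' : G, bpot c T₀ Φ = ddist (rt c Q T₀) Φ ∧
      t ∈ (rt c Q T₀).1 \ Φ.1 ∧ t' ∈ (rt c Q T₀).1 \ Φ.1 ∧ t ≠ t' ∧ gface c hc2 Φ t t' ∈ L) :
    ∀ Φ : CMF G c, 2 ≤ bpot c T₀ Φ → ∃ Q t t' : G, bpot c T₀ Φ = ddist (rt c Q T₀) Φ ∧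
      t ∈ (rt c Q T₀).1 \ Φ.1 ∧ t' ∈ (rt c Q T₀).1 \ Φ.1 ∧ t ≠ t' ∧ gface c hc2 Φ t t' ∈ L := by
  intro Φ hΦ
  by_cases h : far (blk c Φ)
  · exact hon Φ h
  · exact hoff Φ hΦ h

/-- **Residual covering hypothesis from the `toward` property**: if `L = ℤ⟨pairs⟩ + ℤ⟨base changes of S⟩` has a `toward` face through every type
of potential `≥ 2`, then every `[Φ]` lies in `L + ℤ⟨residual types⟩` — the hypothesis `hcov` of
`Splitting.isLeast_card_gfaces_generate_of_residual_reduction`. [folklore] -/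
theorem hcov_of_toward (hc2 : c * c = 1) (S : Finset (CMF G c →₀ ℤ))
    (hL : ∀ Φ : CMF G c, 2 ≤ bpot c T₀ Φ → ∃ Q t t' : G, bpot c T₀ Φ = ddist (rt c Q T₀) Φ ∧
      t ∈ (rt c Q T₀).1 \ Φ.1 ∧ t' ∈ (rt c Q T₀).1 \ Φ.1 ∧ t ≠ t' ∧
        gface c hc2 Φ t t' ∈ Submodule.span ℤ (pairSet c) ⊔ Submodule.span ℤ (translates c S)) (Φ : CMF G c) :
    Finsupp.single Φ (1 : ℤ) ∈ (Submodule.span ℤ (pairSet c) ⊔ Submodule.span ℤ (translates c S)) ⊔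
      Submodule.span ℤ ((fun Ψ => Finsupp.single Ψ (1 : ℤ)) '' {Ψ : CMF G c | bpot c T₀ Ψ ≤ 1}) := by
  obtain ⟨y', hy, hsupp⟩ := descent_of_toward c T₀ hc2 _ hL (Finsupp.single Φ 1)
  have e : Finsupp.single Φ (1 : ℤ) = (Finsupp.single Φ 1 - y') + y' := by abel
  rw [e]
  exact Submodule.add_mem _ (Submodule.mem_sup_left hy) (Submodule.mem_sup_right (mem_span_single_of_support c hsupp))

end

end Summit.HodgeConjecture.CorCM.Census.BaseBlock
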